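import Summits.QuantumFields.YangMills.Theorems.FluctuationComparisonRegPrIntLS2BetaGapFlatOrganFive
import HarnessLib

/-!
# S2β · THE ALL-`L` DOOR FOR THE v12-CANDIDATE ORGAN GAP♭∘: at ONE block size `L` it reads FOUR per-`L` letters (POS∘ at print's regular minimiser, the lifting token,
# Prop. 7 cl. 1, the Thm-1 pair); for ALL `L` it reads their `L = 3` instances ALONE (crux `FluctuationComparisonRegPrIntL`, stmt-QuantumFields-20520)

Cell `ym3-torus` (YM ladder rung R3 = continuum `SU(2)` Yang–Mills on T³ — a RUNG, NOT d = 4, NOT infinite volume, NOT a mass gap, NOT Clay); width seat `ym3-torus-px17`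
(gen 17); `--supports stmt-QuantumFields-20520 --as helper`, count-neutral, DEFINITION-FREE, default heartbeats; registry v11.4 3732b7df UNTOUCHED.

WHAT.  ✓p810821 ∕ ✓p810894 proved GAP♭∘-at-`L` (px17 g14's CERT 603780ac text at `L`) OUTRIGHT at every `L ≥ 5` from four `_five` theorems of the (T)-chain.  This file is the
same composition with those four theorems' CONCLUSIONS AT `L` taken as hypotheses (texts VERBATIM), so that the `_five` edition is an instance and the all-`L` organ text
(`∀ L`, as in the CERT) follows from the four letters AT `L = 3` ALONE (odd `L > 1` other than `3` is `≥ 5`; block sizes carrying no family are vacuous) — the 17fc∕17gk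
pattern («every all-`L` consumer needs only its `L = 3` instance»):
* §1 ★★★ `gapFlat_at_min_of_regArgminBar_of_letters (hL) (hPos) (hLift) (h7)` — ✓`gapFlat_at_min_of_regArgminBar_five` with ✓`posCollar_at_isCritR2_of_lift_five'` (`hPos`),
  ✓`symmetriesLift_of_isCritR2_five` (`hLift`), ✓`atMostOneCriticalOrbit_five` (`h7`) replaced by their conclusion texts at `L`.
* §2 ★★★★ `gapFlatOrganAt_of_letters (hL : 1 < L) (hPos) (hLift) (h7) (hT : ⟨Thm-1 pair at L⟩) : ⟨GAP♭∘-at-L⟩` — REG-ARGMIN̄∘-at-`L` from `hT` (✓`regArgminBarOrganAt_of_thm1Pair`),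
  the base point from `hT` (✓`windowExactnessExistsAt_of_thm1GlobalMinAt`), §1, ✓`gapFlatAt_argmin_of_gapFlatAt`, diagonal ✓`gapOrbit_self`.
* §3 ★★★★ `gapFlatOrgan_of_lettersAtThree (hPos₃) (hLift₃) (h7₃) (hT₃) : ∀ L, ⟨GAP♭∘-at-L⟩` — THE CERT 603780ac ORGAN TEXT FOR ALL `L` ⟸ THE FOUR LETTERS AT `L = 3` ALONE
  (`L ≥ 5`: ✓`gapFlatOrganAt_five`).  The four `L = 3` letters are downstream of EMBARGO-LITE №58 ([Balaban1985RegularSpaces] Thm 2 socket `hThm2S` at `L = 3` + the Thm-1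
  pair at `3`): `hPos₃`∕`hLift₃`∕`h7₃` are the `L = 3` conclusions of theorems whose `_five` proofs bottom out in ✓`hThm2S_body_of_five_le`.

HONEST SCOPE (CREDIT NOTHING): plumbing; the four letters are HYPOTHESES; nothing at `L = 3` is proved; the REGISTERED stub 2 (v11.4 text, `∃ μ` before `∀ F`) is NOT
this organ and is NOT closed; DET-REP-B, H4ᶜ∘, LFR♯ᶜ∘, S2β, crux 20520, 19936, 19200 and `YM3TorusSU2` are NOT proved; rung R3 = SU(2) YM₃ on T³ at fixed lattice data —
NOT d = 4, NOT infinite volume, NOT a mass gap, NOT Clay; the Yang–Mills mass gap is NOT proved.  Sorry-free, axioms standard.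

References: T. Bałaban, CMP **102** (1985) 277–309 [Balaban1985Variational] (Thm 1 (8)–(10) p.279, Prop. 7 and (141)–(143) p.299); CMP **102** (1985) 255–275
[Balaban1985UV3] ((12)–(13) p.259, (18)–(22) p.260); CMP **99** (1985) 75–102 [Balaban1985RegularSpaces] (Thm 2 p.83); CMP **109** (1987) 249–301 [Balaban1987RG1] (§0 p.251).
-/

set_option autoImplicit false

noncomputable section

namespace Summit.QuantumFields.YangMills.Theorems.FluctuationComparisonRegPrIntLS2BetaGapFlatOrganOfLetters

open MeasureTheory Filter Topology Set
open scoped Matrix.Norms.L2Operator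
open Literature.MathematicalPhysics.QuantumFieldTheory.Balaban1983to89
open Literature.MathematicalPhysics.QuantumFieldTheory.Balaban1983to89.T3ContinuumYM3Torus
open Literature.MathematicalPhysics.QuantumFieldTheory.Balaban1983to89.T3UnitLawDensityEML (ℰp)
open Literature.MathematicalPhysics.QuantumFieldTheory.Balaban1983to89.T3UnitScaleTilt
open Literature.MathematicalPhysics.QuantumFieldTheory.Balaban1983to89.T3TiltDescent
open Literature.MathematicalPhysics.QuantumFieldTheory.Balaban1983to89.T3ConstrainedMinimiser (fibre)
open Literature.MathematicalPhysics.QuantumFieldTheory.Balaban1983to89.T3PrintedRegularMinimiser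
open Literature.MathematicalPhysics.QuantumFieldTheory.Balaban1983to89.T3PrintedRegularOrbits (descTransf)
open Literature.MathematicalPhysics.QuantumFieldTheory.Balaban1983to89.T3PrintedMinimiserExistence (Thm1GlobalMinAt)
open Literature.MathematicalPhysics.QuantumFieldTheory.Balaban1983to89.T3Thm1UniquenessSchema (Thm1UniqueMinOrbitAt)
open Literature.MathematicalPhysics.QuantumFieldTheory.Balaban1983to89.T3Thm1Carrier (varProblem3)
open Literature.MathematicalPhysics.QuantumFieldTheory.Balaban1983to89.T3Thm1CarrierNative (IsCritR2 isCritR2_of_isMinOn)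
open Literature.MathematicalPhysics.QuantumFieldTheory.Balaban1983to89.T4Continuum
open scoped Literature.MathematicalPhysics.QuantumFieldTheory.Balaban1983to89.T3OrbitAverage
open Summit.QuantumFields.YangMills.Theorems.FluctuationComparisonRegPrIntLIsolOfOrbBar (gapFlatAt_of_pos_of_atMostOneCriticalOrbit_of_closePair)
open Summit.QuantumFields.YangMills.Theorems.FluctuationComparisonRegPrIntLClosedGoodFibre (exists_gamma_closedGoodFibre)
open Summit.QuantumFields.YangMills.Theorems.FluctuationComparisonRegPrIntLS2BetaWindowCornerQTube (windowExactnessExistsAt_of_thm1GlobalMinAt)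
open Summit.QuantumFields.YangMills.Theorems.FluctuationComparisonRegPrIntLS2BetaTableDiagonalOrgans (gapOrbit_self)
open Summit.QuantumFields.YangMills.Theorems.FluctuationComparisonRegPrIntLS2BetaGapFlatOrganOfRegArgminBar (gapFlatAt_argmin_of_gapFlatAt)
open Summit.QuantumFields.YangMills.Theorems.FluctuationComparisonRegPrIntLS2BetaGapFlatOrganFive (regArgminBarOrganAt_of_thm1Pair gapFlatOrganAt_five)

/-! ## §1 GAP♭ at print's regular good minimiser, uniform `γ₁`, from REG-ARGMIN̄(V) and the three (T)-chain letters AT `L` -/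

section PerDatum

/-- ★★★ **GAP♭(V,U₀) AT PRINT'S REGULAR GOOD MINIMISER, UNIFORMLY IN `γ`, FROM REG-ARGMIN̄(V) — keyed on the three (T)-chain letters AT `L`** (texts = the conclusions of
✓`posCollar_at_isCritR2_of_lift_five'` (`hPos`), ✓`symmetriesLift_of_isCritR2_five` (`hLift`), ✓`atMostOneCriticalOrbit_five` (`h7`) VERBATIM; proof = ✓`gapFlat_at_min_of_regArgminBar_five`'s).
[cite: Balaban1985Variational, Thm 1 (8)-(10) p.279, Prop. 7 and (141)-(143) p.299; Balaban1985UV3, (12)-(13) p.259 and (18)-(22) p.260] -/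
theorem gapFlat_at_min_of_regArgminBar_of_letters {L : ℕ}
    (hPos : ∃ e₉ : ℝ, 0 < e₉ ∧
      ∀ (F : T3Family), F.L = L → ∀ (J K : ℕ) (hJK : J < K) (γ b₀ p₀ ε₀ : ℝ)
        (V : GaugeField (F.P J) 0 (Matrix.specialUnitaryGroup (Fin 2) ℂ)) (U₀ : GaugeField (F.P K) 0 (Matrix.specialUnitaryGroup (Fin 2) ℂ)) (δ : ℝ),
        0 < ε₀ → ε₀ ≤ e₉ → U₀ ∈ regFibrePr F J K hJK.le ε₀ V → IsCritR2 F J K hJK.le V U₀ →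
        wilsonAction4 U₀ = minActionRegPr F J K hJK.le ε₀ V →
        (∀ s : GaugeTransf (F.P J) 0 (Matrix.specialUnitaryGroup (Fin 2) ℂ), GaugeField.gaugeAct s V = V →
            ∃ k : GaugeTransf (F.P K) 0 (Matrix.specialUnitaryGroup (Fin 2) ℂ), GaugeField.gaugeAct k U₀ = U₀ ∧ descTransf F J K hJK.le k = s) →
        ∃ r c : ℝ, 0 < r ∧ 0 < c ∧
          ∀ U ∈ closure (fibre F ℰp J K hJK.le V ∩ histGood F ℰp (θBal F.L γ b₀ p₀) K J),
            (∃ w : Site (F.P K) 0 → Matrix.specialUnitaryGroup (Fin 2) ℂ,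
              (∀ U'' : GaugeField (F.P K) 0 (Matrix.specialUnitaryGroup (Fin 2) ℂ),
                  descendTo F ℰp J K hJK.le (GaugeField.gaugeAct w U'') = descendTo F ℰp J K hJK.le U'') ∧
                ∀ ℓ : PBond (F.P K) 0, dist1 (U ℓ * ((GaugeField.gaugeAct w U₀) ℓ)⁻¹) ≤ δ) →
            (⨅ w : {w : Site (F.P K) 0 → Matrix.specialUnitaryGroup (Fin 2) ℂ |
                  ∀ U : GaugeField (F.P K) 0 (Matrix.specialUnitaryGroup (Fin 2) ℂ),
                    descendTo F ℰp J K hJK.le (GaugeField.gaugeAct w U) = descendTo F ℰp J K hJK.le U},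
                ∑ ℓ : PBond (F.P K) 0,
                  dist1 (U ℓ * ((GaugeField.gaugeAct (w : Site (F.P K) 0 → Matrix.specialUnitaryGroup (Fin 2) ℂ) U₀) ℓ)⁻¹) ^ 2) ≤ r →
            c * (⨅ w : {w : Site (F.P K) 0 → Matrix.specialUnitaryGroup (Fin 2) ℂ |
                  ∀ U : GaugeField (F.P K) 0 (Matrix.specialUnitaryGroup (Fin 2) ℂ),
                    descendTo F ℰp J K hJK.le (GaugeField.gaugeAct w U) = descendTo F ℰp J K hJK.le U},
                ∑ ℓ : PBond (F.P K) 0,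
                  dist1 (U ℓ * ((GaugeField.gaugeAct (w : Site (F.P K) 0 → Matrix.specialUnitaryGroup (Fin 2) ℂ) U₀) ℓ)⁻¹) ^ 2)
              ≤ wilsonAction4 U - minActionRegPr F J K hJK.le ε₀ V)
    (hLift : ∃ e₈ : ℝ, 0 < e₈ ∧
      ∀ (F : T3Family), F.L = L → ∀ (n K : ℕ) (hnK : n < K) (e : ℝ) (V : GaugeField (F.P n) 0 (Matrix.specialUnitaryGroup (Fin 2) ℂ))
        (W : GaugeField (F.P K) 0 (Matrix.specialUnitaryGroup (Fin 2) ℂ)),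
        0 < e → e ≤ e₈ → W ∈ regFibrePr F n K hnK.le e V → IsCritR2 F n K hnK.le V W →
        ∀ s : GaugeTransf (F.P n) 0 (Matrix.specialUnitaryGroup (Fin 2) ℂ), GaugeField.gaugeAct s V = V →
          ∃ k : GaugeTransf (F.P K) 0 (Matrix.specialUnitaryGroup (Fin 2) ℂ), GaugeField.gaugeAct k W = W ∧ descTransf F n K hnK.le k = s)
    (h7 : ∃ e₉ : ℝ, 0 < e₉ ∧
      ∀ (F : T3Family), F.L = L → ∀ (n K : ℕ) (hnK : n < K) (e : ℝ) (V : GaugeField (F.P n) 0 (Matrix.specialUnitaryGroup (Fin 2) ℂ)),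
        0 < e → e ≤ e₉ → (varProblem3 F n K hnK.le).AtMostOneCriticalOrbit e V)
    (b₀ p₀ : ℝ) (hb : 0 < b₀) (hp : 0 < p₀) :
    ∃ e γ₁ : ℝ, 0 < e ∧ 0 < γ₁ ∧
      ∀ (F : T3Family) (γ : ℝ), F.L = L → 0 < γ → γ ≤ γ₁ → ∀ (J K : ℕ) (hJK : J < K) (ε₀ : ℝ)
        (V : GaugeField (F.P J) 0 (Matrix.specialUnitaryGroup (Fin 2) ℂ)) (U₀ : GaugeField (F.P K) 0 (Matrix.specialUnitaryGroup (Fin 2) ℂ)),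
        0 < ε₀ → ε₀ ≤ e → U₀ ∈ regFibrePr F J K hJK.le ε₀ V →
        wilsonAction4 U₀ = minActionRegPr F J K hJK.le ε₀ V → U₀ ∈ histGood F ℰp (θBal F.L γ b₀ p₀) K J →
        (∀ U ∈ closure (fibre F ℰp J K hJK.le V ∩ histGood F ℰp (θBal F.L γ b₀ p₀) K J),
          wilsonAction4 U ≤ minActionRegPr F J K hJK.le ε₀ V → RegPr F J K ε₀ U) →
        ∃ μ : ℝ, 0 < μ ∧ ∀ U ∈ fibre F ℰp J K hJK.le V, U ∈ histGood F ℰp (θBal F.L γ b₀ p₀) K J →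
          μ * ((F.L : ℝ)⁻¹) ^ (2 * (K - J)) *
              (⨅ w : {w : Site (F.P K) 0 → Matrix.specialUnitaryGroup (Fin 2) ℂ |
                  ∀ U : GaugeField (F.P K) 0 (Matrix.specialUnitaryGroup (Fin 2) ℂ),
                    descendTo F ℰp J K hJK.le (GaugeField.gaugeAct w U) = descendTo F ℰp J K hJK.le U},
                ∑ ℓ : PBond (F.P K) 0,
                  dist1 (U ℓ * ((GaugeField.gaugeAct (w : Site (F.P K) 0 → Matrix.specialUnitaryGroup (Fin 2) ℂ) U₀) ℓ)⁻¹) ^ 2)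
            ≤ wilsonAction4 U - minActionRegPr F J K hJK.le ε₀ V := by
  obtain ⟨e₈, he₈, HP⟩ := hPos
  obtain ⟨e₈', he₈', HL⟩ := hLift
  obtain ⟨e₉, he₉, H7⟩ := h7
  obtain ⟨γCL, hγCL, -, HCL⟩ := exists_gamma_closedGoodFibre L (b₀ := b₀) (p₀ := p₀) hb hp
  obtain ⟨γ₁, hγ₁, HG⟩ := gapFlatAt_of_pos_of_atMostOneCriticalOrbit_of_closePair L b₀ p₀ hb hp 1 one_pos
  refine ⟨min e₈ (min e₈' e₉), min γCL γ₁, lt_min he₈ (lt_min he₈' he₉), lt_min hγCL hγ₁, ?_⟩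
  intro F γ hF hγ hγle J K hJK ε₀ V U₀ hε₀ hεe hU₀reg hmin hU₀h hRA
  have hcrit : IsCritR2 F J K hJK.le V U₀ :=
    isCritR2_of_isMinOn hε₀ hU₀reg (isMinOn_iff.mpr fun W hW => hmin.trans_le (minActionRegPr_le F hW))
  have hlift := HL F hF J K hJK ε₀ V U₀ hε₀ (hεe.trans ((min_le_right _ _).trans (min_le_left _ _))) hU₀reg hcrit
  have hpos := HP F hF J K hJK γ b₀ p₀ ε₀ V U₀ 1 hε₀ (hεe.trans (min_le_left _ _)) hU₀reg hcrit hmin hlift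
  have h7' := H7 F hF J K hJK ε₀ V hε₀ (hεe.trans ((min_le_right _ _).trans (min_le_right _ _)))
  have hCL := HCL F γ hF hγ (hγle.trans (min_le_left _ _)) J K hJK.le V
  exact HG F γ hF hγ (hγle.trans (min_le_right _ _)) J K hJK.le ε₀ hε₀ V h7' U₀ hU₀reg hmin hU₀h hRA hCL hpos

end PerDatum

/-! ## §2 ★★★★ GAP♭∘ AT `L` FROM THE FOUR LETTERS AT `L` -/

section Organ

/-- ★★★★ **GAP♭∘-at-`L` ⟸ {POS∘ letter, lifting letter, Prop. 7 cl. 1 letter, Thm-1 pair} AT `L`** (every `L > 1`; conclusion = px17 g14's CERT 603780ac organ text at `L`,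
δ-unfolded as ✓`orb_of_gapFlat`'s `hG`).  REG-ARGMIN̄∘-at-`L` comes from the Thm-1 pair (✓`regArgminBarOrganAt_of_thm1Pair`), the base point from its first half
(✓`windowExactnessExistsAt_of_thm1GlobalMinAt`), GAP♭ at the base point from §1, the transfer to `argminHist` from ✓`gapFlatAt_argmin_of_gapFlatAt`, the diagonal from
✓`gapOrbit_self`.  ✓`gapFlatOrganAt_five` is the instance at the four `_five` theorems. [cite: Balaban1985Variational, Thm 1 (8)-(10) p.279, Prop. 7 and (142) p.299; Balaban1985UV3, (18)-(22) p.260] -/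
theorem gapFlatOrganAt_of_letters {L : ℕ} (hL : 1 < L)
    (hPos : ∃ e₉ : ℝ, 0 < e₉ ∧
      ∀ (F : T3Family), F.L = L → ∀ (J K : ℕ) (hJK : J < K) (γ b₀ p₀ ε₀ : ℝ)
        (V : GaugeField (F.P J) 0 (Matrix.specialUnitaryGroup (Fin 2) ℂ)) (U₀ : GaugeField (F.P K) 0 (Matrix.specialUnitaryGroup (Fin 2) ℂ)) (δ : ℝ),
        0 < ε₀ → ε₀ ≤ e₉ → U₀ ∈ regFibrePr F J K hJK.le ε₀ V → IsCritR2 F J K hJK.le V U₀ →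
        wilsonAction4 U₀ = minActionRegPr F J K hJK.le ε₀ V →
        (∀ s : GaugeTransf (F.P J) 0 (Matrix.specialUnitaryGroup (Fin 2) ℂ), GaugeField.gaugeAct s V = V →
            ∃ k : GaugeTransf (F.P K) 0 (Matrix.specialUnitaryGroup (Fin 2) ℂ), GaugeField.gaugeAct k U₀ = U₀ ∧ descTransf F J K hJK.le k = s) →
        ∃ r c : ℝ, 0 < r ∧ 0 < c ∧
          ∀ U ∈ closure (fibre F ℰp J K hJK.le V ∩ histGood F ℰp (θBal F.L γ b₀ p₀) K J),
            (∃ w : Site (F.P K) 0 → Matrix.specialUnitaryGroup (Fin 2) ℂ,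
              (∀ U'' : GaugeField (F.P K) 0 (Matrix.specialUnitaryGroup (Fin 2) ℂ),
                  descendTo F ℰp J K hJK.le (GaugeField.gaugeAct w U'') = descendTo F ℰp J K hJK.le U'') ∧
                ∀ ℓ : PBond (F.P K) 0, dist1 (U ℓ * ((GaugeField.gaugeAct w U₀) ℓ)⁻¹) ≤ δ) →
            (⨅ w : {w : Site (F.P K) 0 → Matrix.specialUnitaryGroup (Fin 2) ℂ |
                  ∀ U : GaugeField (F.P K) 0 (Matrix.specialUnitaryGroup (Fin 2) ℂ),
                    descendTo F ℰp J K hJK.le (GaugeField.gaugeAct w U) = descendTo F ℰp J K hJK.le U},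
                ∑ ℓ : PBond (F.P K) 0,
                  dist1 (U ℓ * ((GaugeField.gaugeAct (w : Site (F.P K) 0 → Matrix.specialUnitaryGroup (Fin 2) ℂ) U₀) ℓ)⁻¹) ^ 2) ≤ r →
            c * (⨅ w : {w : Site (F.P K) 0 → Matrix.specialUnitaryGroup (Fin 2) ℂ |
                  ∀ U : GaugeField (F.P K) 0 (Matrix.specialUnitaryGroup (Fin 2) ℂ),
                    descendTo F ℰp J K hJK.le (GaugeField.gaugeAct w U) = descendTo F ℰp J K hJK.le U},
                ∑ ℓ : PBond (F.P K) 0,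
                  dist1 (U ℓ * ((GaugeField.gaugeAct (w : Site (F.P K) 0 → Matrix.specialUnitaryGroup (Fin 2) ℂ) U₀) ℓ)⁻¹) ^ 2)
              ≤ wilsonAction4 U - minActionRegPr F J K hJK.le ε₀ V)
    (hLift : ∃ e₈ : ℝ, 0 < e₈ ∧
      ∀ (F : T3Family), F.L = L → ∀ (n K : ℕ) (hnK : n < K) (e : ℝ) (V : GaugeField (F.P n) 0 (Matrix.specialUnitaryGroup (Fin 2) ℂ))
        (W : GaugeField (F.P K) 0 (Matrix.specialUnitaryGroup (Fin 2) ℂ)),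
        0 < e → e ≤ e₈ → W ∈ regFibrePr F n K hnK.le e V → IsCritR2 F n K hnK.le V W →
        ∀ s : GaugeTransf (F.P n) 0 (Matrix.specialUnitaryGroup (Fin 2) ℂ), GaugeField.gaugeAct s V = V →
          ∃ k : GaugeTransf (F.P K) 0 (Matrix.specialUnitaryGroup (Fin 2) ℂ), GaugeField.gaugeAct k W = W ∧ descTransf F n K hnK.le k = s)
    (h7 : ∃ e₉ : ℝ, 0 < e₉ ∧
      ∀ (F : T3Family), F.L = L → ∀ (n K : ℕ) (hnK : n < K) (e : ℝ) (V : GaugeField (F.P n) 0 (Matrix.specialUnitaryGroup (Fin 2) ℂ)),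
        0 < e → e ≤ e₉ → (varProblem3 F n K hnK.le).AtMostOneCriticalOrbit e V)
    (hT : ∃ a₀ a₁ B₃ : ℝ, 0 < a₀ ∧ 0 < a₁ ∧ 0 < B₃ ∧ Thm1GlobalMinAt L a₀ a₁ B₃ ∧ Thm1UniqueMinOrbitAt L a₀ a₁ B₃) :
    ∃ c₀ : ℝ, 0 < c₀ ∧ c₀ ≤ 1 ∧ ∀ (cw : ℝ), 0 < cw → cw ≤ c₀ → ∃ pS : ℝ, ∀ (b₀ p₀ : ℝ), 0 < b₀ → pS ≤ p₀ → 0 < p₀ →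
      ∃ ε₁ : ℝ, 0 < ε₁ ∧ ∀ (ε₀ : ℝ), 0 < ε₀ → ε₀ ≤ ε₁ →
      ∃ γ₁ : ℝ, 0 < γ₁ ∧ ∀ (F : T3Family) (γ : ℝ), F.L = L → 0 < γ → γ ≤ γ₁ →
        ∀ (J K : ℕ) (hJK : J ≤ K) (V : GaugeField (F.P J) 0 (Matrix.specialUnitaryGroup (Fin 2) ℂ)), PlaqSmall (θBal F.L γ (cw * b₀) p₀ J) V →
          ∀ U₀ ∈ {U' | U' ∈ fibre F ℰp J K hJK V ∧ U' ∈ histGood F ℰp (θBal F.L γ b₀ p₀) K J ∧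
              wilsonAction4 U' = minActionRegPr F J K hJK ε₀ V}, ∃ μ : ℝ, 0 < μ ∧
            ∀ U ∈ fibre F ℰp J K hJK V, U ∈ histGood F ℰp (θBal F.L γ b₀ p₀) K J →
              μ * ((F.L : ℝ)⁻¹) ^ (2 * (K - J)) *
                  (⨅ w : {w : Site (F.P K) 0 → Matrix.specialUnitaryGroup (Fin 2) ℂ |
                      ∀ U : GaugeField (F.P K) 0 (Matrix.specialUnitaryGroup (Fin 2) ℂ),
                        descendTo F ℰp J K hJK (GaugeField.gaugeAct w U) = descendTo F ℰp J K hJK U},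
                    ∑ ℓ : PBond (F.P K) 0,
                      dist1 (U ℓ * ((GaugeField.gaugeAct (w : Site (F.P K) 0 → Matrix.specialUnitaryGroup (Fin 2) ℂ) U₀) ℓ)⁻¹) ^ 2)
                ≤ wilsonAction4 U - minActionRegPr F J K hJK ε₀ V := by
  obtain ⟨a₀, a₁, B₃, ha₀, ha₁, hB₃, hT1, hU1⟩ := hT
  obtain ⟨c₁, hc₁, hc₁1, h₁⟩ := windowExactnessExistsAt_of_thm1GlobalMinAt L ⟨a₀, a₁, B₃, ha₀, ha₁, hB₃, hT1⟩
  obtain ⟨c₂, hc₂, -, h₂⟩ := regArgminBarOrganAt_of_thm1Pair hL ha₀ ha₁ hB₃ hT1 hU1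
  refine ⟨min c₁ c₂, lt_min hc₁ hc₂, (min_le_left _ _).trans hc₁1, fun cw hcw0 hcwle => ?_⟩
  obtain ⟨pS₁, h₁'⟩ := h₁ cw hcw0 (hcwle.trans (min_le_left _ _))
  obtain ⟨pS₂, h₂'⟩ := h₂ cw hcw0 (hcwle.trans (min_le_right _ _))
  refine ⟨max pS₁ pS₂, fun b₀ p₀ hb hpS hp => ?_⟩
  obtain ⟨ε₁, hε₁, h₁''⟩ := h₁' b₀ p₀ hb ((le_max_left _ _).trans hpS) hp
  obtain ⟨ε₂, hε₂, h₂''⟩ := h₂' b₀ p₀ hb ((le_max_right _ _).trans hpS) hp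
  obtain ⟨e, γG, he, hγG, HG⟩ := gapFlat_at_min_of_regArgminBar_of_letters hPos hLift h7 b₀ p₀ hb hp
  refine ⟨min ε₁ (min ε₂ e), lt_min hε₁ (lt_min hε₂ he), fun ε₀ hε₀ hε₀le => ?_⟩
  obtain ⟨γa, hγa, H₁⟩ := h₁'' ε₀ hε₀ (hε₀le.trans (min_le_left _ _))
  obtain ⟨γb, hγb, H₂⟩ := h₂'' ε₀ hε₀ (hε₀le.trans ((min_le_right _ _).trans (min_le_left _ _)))
  refine ⟨min γa (min γb γG), lt_min hγa (lt_min hγb hγG), fun F γ hFL hγ hγle J K hJK V hV U₀ hU₀ => ?_⟩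
  by_cases hJKeq : J = K
  · subst hJKeq
    exact ⟨1, one_pos, fun U hU _ => gapOrbit_self F one_pos hJK hU₀ hU⟩
  have hlt : J < K := lt_of_le_of_ne hJK hJKeq
  obtain ⟨U₁, hU₁reg, hU₁good, hU₁min⟩ := H₁ F γ hFL hγ (hγle.trans (min_le_left _ _)) J K hJK V hV
  have hRAV := H₂ F γ hFL hγ (hγle.trans ((min_le_right _ _).trans (min_le_left _ _))) J K hJK V hV
  obtain ⟨μ, hμ, hGap⟩ := HG F γ hFL hγ (hγle.trans ((min_le_right _ _).trans (min_le_right _ _))) J K hlt ε₀ V U₁ hε₀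
    (hε₀le.trans ((min_le_right _ _).trans (min_le_right _ _))) hU₁reg hU₁min hU₁good hRAV
  exact ⟨μ, hμ, gapFlatAt_argmin_of_gapFlatAt F hJK hε₀.le V ((mem_regFibrePr_iff F).mp hU₁reg).1 hμ hGap U₀ hU₀⟩

end Organ

/-! ## §3 ★★★★ THE ORGAN FOR ALL `L` FROM THE FOUR LETTERS AT `L = 3` ALONE -/

section AllL

/-- ★★★★ **px17 g14's v12-CANDIDATE ORGAN GAP♭∘ FOR ALL `L` (CERT 603780ac `def UniformFibreGapOrbit` VERBATIM shape, δ-unfolded) ⟸ THE FOUR LETTERS AT `L = 3` ALONE**: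
`L = 3` by §2; odd `L > 1` other than `3` is `≥ 5` (✓`gapFlatOrganAt_five`); a block size carrying no family (`Odd L ∧ 1 < L` fails) is vacuous past `F.L = L`.
[cite: Balaban1985Variational, Thm 1 (8)-(10) p.279, Prop. 7 and (142) p.299; Balaban1987RG1, §0 p.251] -/
theorem gapFlatOrgan_of_lettersAtThree
    (hPos₃ : ∃ e₉ : ℝ, 0 < e₉ ∧
      ∀ (F : T3Family), F.L = 3 → ∀ (J K : ℕ) (hJK : J < K) (γ b₀ p₀ ε₀ : ℝ)
        (V : GaugeField (F.P J) 0 (Matrix.specialUnitaryGroup (Fin 2) ℂ)) (U₀ : GaugeField (F.P K) 0 (Matrix.specialUnitaryGroup (Fin 2) ℂ)) (δ : ℝ),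
        0 < ε₀ → ε₀ ≤ e₉ → U₀ ∈ regFibrePr F J K hJK.le ε₀ V → IsCritR2 F J K hJK.le V U₀ →
        wilsonAction4 U₀ = minActionRegPr F J K hJK.le ε₀ V →
        (∀ s : GaugeTransf (F.P J) 0 (Matrix.specialUnitaryGroup (Fin 2) ℂ), GaugeField.gaugeAct s V = V →
            ∃ k : GaugeTransf (F.P K) 0 (Matrix.specialUnitaryGroup (Fin 2) ℂ), GaugeField.gaugeAct k U₀ = U₀ ∧ descTransf F J K hJK.le k = s) →
        ∃ r c : ℝ, 0 < r ∧ 0 < c ∧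
          ∀ U ∈ closure (fibre F ℰp J K hJK.le V ∩ histGood F ℰp (θBal F.L γ b₀ p₀) K J),
            (∃ w : Site (F.P K) 0 → Matrix.specialUnitaryGroup (Fin 2) ℂ,
              (∀ U'' : GaugeField (F.P K) 0 (Matrix.specialUnitaryGroup (Fin 2) ℂ),
                  descendTo F ℰp J K hJK.le (GaugeField.gaugeAct w U'') = descendTo F ℰp J K hJK.le U'') ∧
                ∀ ℓ : PBond (F.P K) 0, dist1 (U ℓ * ((GaugeField.gaugeAct w U₀) ℓ)⁻¹) ≤ δ) →
            (⨅ w : {w : Site (F.P K) 0 → Matrix.specialUnitaryGroup (Fin 2) ℂ |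
                  ∀ U : GaugeField (F.P K) 0 (Matrix.specialUnitaryGroup (Fin 2) ℂ),
                    descendTo F ℰp J K hJK.le (GaugeField.gaugeAct w U) = descendTo F ℰp J K hJK.le U},
                ∑ ℓ : PBond (F.P K) 0,
                  dist1 (U ℓ * ((GaugeField.gaugeAct (w : Site (F.P K) 0 → Matrix.specialUnitaryGroup (Fin 2) ℂ) U₀) ℓ)⁻¹) ^ 2) ≤ r →
            c * (⨅ w : {w : Site (F.P K) 0 → Matrix.specialUnitaryGroup (Fin 2) ℂ |
                  ∀ U : GaugeField (F.P K) 0 (Matrix.specialUnitaryGroup (Fin 2) ℂ),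
                    descendTo F ℰp J K hJK.le (GaugeField.gaugeAct w U) = descendTo F ℰp J K hJK.le U},
                ∑ ℓ : PBond (F.P K) 0,
                  dist1 (U ℓ * ((GaugeField.gaugeAct (w : Site (F.P K) 0 → Matrix.specialUnitaryGroup (Fin 2) ℂ) U₀) ℓ)⁻¹) ^ 2)
              ≤ wilsonAction4 U - minActionRegPr F J K hJK.le ε₀ V)
    (hLift₃ : ∃ e₈ : ℝ, 0 < e₈ ∧
      ∀ (F : T3Family), F.L = 3 → ∀ (n K : ℕ) (hnK : n < K) (e : ℝ) (V : GaugeField (F.P n) 0 (Matrix.specialUnitaryGroup (Fin 2) ℂ))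
        (W : GaugeField (F.P K) 0 (Matrix.specialUnitaryGroup (Fin 2) ℂ)),
        0 < e → e ≤ e₈ → W ∈ regFibrePr F n K hnK.le e V → IsCritR2 F n K hnK.le V W →
        ∀ s : GaugeTransf (F.P n) 0 (Matrix.specialUnitaryGroup (Fin 2) ℂ), GaugeField.gaugeAct s V = V →
          ∃ k : GaugeTransf (F.P K) 0 (Matrix.specialUnitaryGroup (Fin 2) ℂ), GaugeField.gaugeAct k W = W ∧ descTransf F n K hnK.le k = s)
    (h7₃ : ∃ e₉ : ℝ, 0 < e₉ ∧
      ∀ (F : T3Family), F.L = 3 → ∀ (n K : ℕ) (hnK : n < K) (e : ℝ) (V : GaugeField (F.P n) 0 (Matrix.specialUnitaryGroup (Fin 2) ℂ)),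
        0 < e → e ≤ e₉ → (varProblem3 F n K hnK.le).AtMostOneCriticalOrbit e V)
    (hT₃ : ∃ a₀ a₁ B₃ : ℝ, 0 < a₀ ∧ 0 < a₁ ∧ 0 < B₃ ∧ Thm1GlobalMinAt 3 a₀ a₁ B₃ ∧ Thm1UniqueMinOrbitAt 3 a₀ a₁ B₃) :
    ∀ (L : ℕ), ∃ c₀ : ℝ, 0 < c₀ ∧ c₀ ≤ 1 ∧ ∀ (cw : ℝ), 0 < cw → cw ≤ c₀ → ∃ pS : ℝ, ∀ (b₀ p₀ : ℝ), 0 < b₀ → pS ≤ p₀ → 0 < p₀ →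
      ∃ ε₁ : ℝ, 0 < ε₁ ∧ ∀ (ε₀ : ℝ), 0 < ε₀ → ε₀ ≤ ε₁ →
      ∃ γ₁ : ℝ, 0 < γ₁ ∧ ∀ (F : T3Family) (γ : ℝ), F.L = L → 0 < γ → γ ≤ γ₁ →
        ∀ (J K : ℕ) (hJK : J ≤ K) (V : GaugeField (F.P J) 0 (Matrix.specialUnitaryGroup (Fin 2) ℂ)), PlaqSmall (θBal F.L γ (cw * b₀) p₀ J) V →
          ∀ U₀ ∈ {U' | U' ∈ fibre F ℰp J K hJK V ∧ U' ∈ histGood F ℰp (θBal F.L γ b₀ p₀) K J ∧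
              wilsonAction4 U' = minActionRegPr F J K hJK ε₀ V}, ∃ μ : ℝ, 0 < μ ∧
            ∀ U ∈ fibre F ℰp J K hJK V, U ∈ histGood F ℰp (θBal F.L γ b₀ p₀) K J →
              μ * ((F.L : ℝ)⁻¹) ^ (2 * (K - J)) *
                  (⨅ w : {w : Site (F.P K) 0 → Matrix.specialUnitaryGroup (Fin 2) ℂ |
                      ∀ U : GaugeField (F.P K) 0 (Matrix.specialUnitaryGroup (Fin 2) ℂ),
                        descendTo F ℰp J K hJK (GaugeField.gaugeAct w U) = descendTo F ℰp J K hJK U},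
                    ∑ ℓ : PBond (F.P K) 0,
                      dist1 (U ℓ * ((GaugeField.gaugeAct (w : Site (F.P K) 0 → Matrix.specialUnitaryGroup (Fin 2) ℂ) U₀) ℓ)⁻¹) ^ 2)
                ≤ wilsonAction4 U - minActionRegPr F J K hJK ε₀ V := by
  intro L
  by_cases h3 : L = 3
  · subst h3
    exact gapFlatOrganAt_of_letters (by norm_num) hPos₃ hLift₃ h7₃ hT₃
  by_cases hL : Odd L ∧ 1 < L
  · have h5 : 5 ≤ L := by
      obtain ⟨m, rfl⟩ := hL.1
      omega
    exact gapFlatOrganAt_five L h5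
  · -- no member of the family has this block size: everything past `F.L = L` is vacuous
    refine ⟨1, one_pos, le_rfl, fun cw _ _ => ⟨0, fun b₀ p₀ _ _ _ => ⟨1, one_pos, fun ε₀ _ _ => ⟨1, one_pos, ?_⟩⟩⟩⟩
    intro F γ hFL
    exact absurd (hFL ▸ F.hL) hL

end AllL

end Summit.QuantumFields.YangMills.Theorems.FluctuationComparisonRegPrIntLS2BetaGapFlatOrganOfLetters

end
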